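import Literature.NumberTheory.Transcendental.FormIntegrationAddProofs
import Mathlib.Analysis.Calculus.ParametricIntegral
import HarnessLib

/-!
# Differentiation under the integral sign for `∫_M`: parameter-dependent top forms

Topic: integration of differential forms on compact oriented manifolds (companion of
`FormIntegration.lean` / `FormIntegrationAddProofs.lean`). Theorems only.

Let `M` be a compact manifold without boundary with a continuous orientation family `o`, and
`F : P → A^n(M)` a family of top-degree forms parametrised by a finite-dimensional real normed
space `P`. If the family is `C¹` jointly in the parameter and the point — in the chart-wise sense
that for every chart centre `i` the coefficient `(p, y) ↦ (F p)̂_i(y)(e₁, …, eₙ)` of the chart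
representative is `C¹` on `U × (chart target)` for an open `U ∋ p₀` — then
`p ↦ ∫_M F p` is differentiable at `p₀`, and its derivative is obtained by differentiating under
the integral sign (`hasFDerivAt_integral_of_contDiffOn`): chart by chart this is Mathlib's
`hasFDerivAt_integral_of_dominated_of_fderiv_le` (domination by a constant on the compact image
of the support of the partition function, continuity of the parameter derivative), and the
defining sum of `∫_M` is finite on a compact manifold. If moreover the pointwise parameter
derivatives `∂_p (F p x)|_{p₀}` are known, `x ↦ G x`, then the derivative in the direction `h`
is `∫_M (x ↦ G x h)` (`hasFDerivAt_integral_of_contDiffOn_of_hasFDerivAt`). Lee (2013), Ch. 16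
(integration on manifolds) with the classical Leibniz rule; no literature counterpart beyond
folklore.

## References

* J. M. Lee, *Introduction to Smooth Manifolds*, 2nd ed. (2013), Prop. 16.5, 16.6.
  [LeeSmoothManifolds2013]
* F. W. Warner, *Foundations of Differentiable Manifolds and Lie Groups* (1983), 4.8. [Warner1983]
-/

noncomputable section

open scoped Manifold ContDiff Topology
open Bundle Set Module MeasureTheory Function Filter Metric

namespace Literature.NumberTheory.Transcendental

-- The identification `TangentSpace I x = E` is an abuse of definitional equality; as in the
-- tree's form files we let `isDefEq` unfold it.
set_option backward.isDefEq.respectTransparency false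

variable {E : Type*} [NormedAddCommGroup E] [NormedSpace ℝ E] [FiniteDimensional ℝ E]
  {n : ℕ} [Fact (finrank ℝ E = n)]
  {H : Type*} [TopologicalSpace H] {I : ModelWithCorners ℝ E H} [I.Boundaryless]
  {M : Type*} [TopologicalSpace M] [ChartedSpace H M] [IsManifold I ∞ M]
  {o : (x : M) → Orientation ℝ (TangentSpace I x) (Fin n)}
  [MeasurableSpace E] [BorelSpace E] [T2Space M] [SigmaCompactSpace M] [CompactSpace M]
  {P : Type*} [NormedAddCommGroup P] [NormedSpace ℝ P] [FiniteDimensional ℝ P]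

omit [I.Boundaryless] [IsManifold I ∞ M] [MeasurableSpace E] [BorelSpace E] [T2Space M]
  [SigmaCompactSpace M] [CompactSpace M] in
/-- `|chartSign| ≤ 1` (it is a real sign). [folklore] -/
theorem abs_chartSign_le_one (o : (x : M) → Orientation ℝ (TangentSpace I x) (Fin n)) (i : M)
    (y : E) : |chartSign o i y| ≤ 1 := by
  unfold chartSign
  rcases Real.sign_apply_eq _ with h | h | h <;> rw [h] <;> norm_num

omit [I.Boundaryless] [MeasurableSpace E] [BorelSpace E] [CompactSpace M] in
/-- The partition functions take values in `[0, 1]`, so `|ρ i x| ≤ 1`. [folklore] -/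
theorem abs_chartPartitionOfUnity_le_one (i x : M) : |chartPartitionOfUnity I M i x| ≤ 1 := by
  rw [abs_le]
  exact ⟨(neg_one_lt_zero.le).trans ((chartPartitionOfUnity I M).nonneg i x),
    (chartPartitionOfUnity I M).le_one i x⟩

omit [I.Boundaryless] [MeasurableSpace E] [BorelSpace E] in
/-- **Only finitely many partition functions are not identically zero** on a compact manifold
(the chosen partition of unity is locally finite). [cite: LeeSmoothManifolds2013, Prop. 16.5] -/
theorem finite_setOf_chartPartitionOfUnity_ne_zero :
    {i : M | (chartPartitionOfUnity I M i : M → ℝ) ≠ 0}.Finite := by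
  refine ((chartPartitionOfUnity I M).locallyFinite.finite_nonempty_of_compact).subset
    fun i hi ↦ ?_
  by_contra h
  apply hi
  funext x
  by_contra hx
  exact h ⟨x, hx⟩

/-- **Differentiation under `∫_M` (Leibniz rule for parameter-dependent top forms).** Let
`F : P → A^n(M)` be a family of top forms on a compact boundaryless manifold with continuous
orientation family `o`, parametrised by a finite-dimensional normed space `P`, such that for an
open `U ∋ p₀` and every chart centre `i : M` the chart coefficient
`(p, y) ↦ (F p).inChart i y (e₁, …, eₙ)` is `C¹` on `U × (extChartAt I i).target`. Then
`p ↦ ∫_M F p` has a derivative `L` at `p₀`, and `L h` is the defining chart sum of `∫_M` applied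
to the chart-wise parameter derivatives `y ↦ ∂_p [(F p).inChart i y (e)]|_{p₀} h`.
[cite: LeeSmoothManifolds2013, Prop. 16.6] -/
theorem hasFDerivAt_integral_of_contDiffOn (ho : IsContinuousOrientation o)
    (F : P → Literature.Geometry.Kaehler.MForm I M ℝ n) {p₀ : P} {U : Set P} (hU : IsOpen U)
    (hp₀ : p₀ ∈ U)
    (hF : ∀ i : M, ContDiffOn ℝ 1 (fun q : P × E ↦ (F q.1).inChart i q.2 (modelBasis E n))
      (U ×ˢ (extChartAt I i).target)) :
    ∃ L : P →L[ℝ] ℝ, HasFDerivAt (fun p ↦ (F p).integral o) L p₀ ∧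
      ∀ h, L h = ∑ᶠ i : M, ∫ y in (extChartAt I i).target,
        chartSign o i y * chartPartitionOfUnity I M i ((extChartAt I i).symm y) *
          fderiv ℝ (fun p ↦ (F p).inChart i y (modelBasis E n)) p₀ h ∂(modelBasis E n).addHaar := by
  classical
  -- notation: partition functions, chart coefficient, chart integrands and their derivatives
  set ρ := chartPartitionOfUnity I M with hρ
  set e := modelBasis E n with he
  set Φ : M → P × E → ℝ := fun i q ↦ (F q.1).inChart i q.2 e with hΦ
  set g : M → P → E → ℝ := fun i p y ↦
    chartSign o i y * ρ i ((extChartAt I i).symm y) * Φ i (p, y) with hg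
  set g' : M → P → E → (P →L[ℝ] ℝ) := fun i p y ↦
    (chartSign o i y * ρ i ((extChartAt I i).symm y)) •
      (fderiv ℝ (Φ i) (p, y)).comp (ContinuousLinearMap.inl ℝ P E) with hg'
  -- the finite set of relevant charts
  set S : Finset M := (finite_setOf_chartPartitionOfUnity_ne_zero (I := I) (M := M)).toFinset with hS
  have hS0 : ∀ i ∉ S, ∀ x, ρ i x = 0 := by
    intro i hi x
    by_contra hx
    apply hi
    rw [hS, Finite.mem_toFinset]
    exact fun h0 ↦ hx (by rw [hρ, h0]; rfl)
  -- the integral as a finite sum of chart integrals, for every parameter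
  have hsum : ∀ p, (F p).integral o = ∑ i ∈ S, ∫ y in (extChartAt I i).target, g i p y ∂e.addHaar := by
    intro p
    change ∑ᶠ i : M, _ = _
    apply finsum_eq_sum_of_support_subset
    intro i hi
    by_contra hiS
    apply hi
    have h0 : ∀ x, chartPartitionOfUnity I M i x = 0 := hS0 i hiS
    simp only [h0, mul_zero, zero_mul, integral_zero]
  -- basic sets: chart targets are open (boundaryless), `U × target` is open
  have htarget : ∀ i : M, IsOpen (extChartAt I i).target := fun i ↦ isOpen_extChartAt_target i
  have hopen : ∀ i : M, IsOpen (U ×ˢ (extChartAt I i).target) := fun i ↦ hU.prod (htarget i)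
  -- compact support images
  have hsub : ∀ i : M, tsupport (ρ i) ⊆ (extChartAt I i).source := fun i ↦ by
    rw [extChartAt_source]; exact chartPartitionOfUnity_isSubordinate i
  set K : M → Set E := fun i ↦ extChartAt I i '' tsupport (ρ i) with hK
  have hKc : ∀ i, IsCompact (K i) := fun i ↦
    (isClosed_tsupport _).isCompact.image_of_continuousOn ((continuousOn_extChartAt i).mono (hsub i))
  have hKt : ∀ i, K i ⊆ (extChartAt I i).target := by
    rintro i _ ⟨x, hx, rfl⟩
    exact (extChartAt I i).map_source (hsub i hx)
  have hρ0 : ∀ i, ∀ y ∈ (extChartAt I i).target, y ∉ K i → ρ i ((extChartAt I i).symm y) = 0 := by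
    intro i y hy hyK
    by_contra h
    exact hyK ⟨(extChartAt I i).symm y, subset_tsupport _ h, (extChartAt I i).right_inv hy⟩
  -- a closed ball around `p₀` inside `U`
  obtain ⟨ε, hε, hball⟩ : ∃ ε > 0, closedBall p₀ ε ⊆ U := nhds_basis_closedBall.mem_iff.1 (hU.mem_nhds hp₀)
  -- continuity of the pieces on the chart targets
  have hcs : ∀ i, ContinuousOn (chartSign o i) (extChartAt I i).target := fun i ↦ ho.continuousOn_chartSign i
  have hcρ : ∀ i, ContinuousOn (fun y ↦ ρ i ((extChartAt I i).symm y)) (extChartAt I i).target := fun i ↦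
    (map_continuous (ρ i)).comp_continuousOn (continuousOn_extChartAt_symm i)
  have hΦc : ∀ i, ∀ p ∈ U, ContinuousOn (fun y ↦ Φ i (p, y)) (extChartAt I i).target := by
    intro i p hp y hy
    exact ((hF i).continuousOn (p, y) ⟨hp, hy⟩).comp
      (continuous_const.prodMk continuous_id).continuousWithinAt (fun y' hy' ↦ ⟨hp, hy'⟩)
  have hΦ'c : ∀ i, ContinuousOn (fun q : P × E ↦ fderiv ℝ (Φ i) q) (U ×ˢ (extChartAt I i).target) :=
    fun i ↦ (hF i).continuousOn_fderiv_of_isOpen (hopen i) le_rfl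
  have hΦd : ∀ i, ∀ q ∈ U ×ˢ (extChartAt I i).target, HasFDerivAt (Φ i) (fderiv ℝ (Φ i) q) q :=
    fun i q hq ↦ (((hF i).contDiffAt ((hopen i).mem_nhds hq)).differentiableAt one_ne_zero).hasFDerivAt
  -- measurability of the chart targets
  have hmeas : ∀ i : M, MeasurableSet (extChartAt I i).target := fun i ↦ (htarget i).measurableSet
  -- continuity of `g i p` on the target for `p ∈ U`, and of `(p, y) ↦ g' i p y` on `U × target`
  have hgc : ∀ i, ∀ p ∈ U, ContinuousOn (g i p) (extChartAt I i).target := fun i p hp ↦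
    ((hcs i).mul (hcρ i)).mul (hΦc i p hp)
  have hg'c : ∀ i, ContinuousOn (fun q : P × E ↦ g' i q.1 q.2) (U ×ˢ (extChartAt I i).target) := by
    intro i
    have h1 : ContinuousOn (fun q : P × E ↦ chartSign o i q.2 * ρ i ((extChartAt I i).symm q.2))
        (U ×ˢ (extChartAt I i).target) :=
      ((hcs i).mul (hcρ i)).comp continuous_snd.continuousOn fun q hq ↦ hq.2
    have h2 : ContinuousOn (fun q : P × E ↦ (fderiv ℝ (Φ i) q).comp (ContinuousLinearMap.inl ℝ P E))
        (U ×ˢ (extChartAt I i).target) :=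
      (hΦ'c i).clm_comp continuousOn_const
    -- (`g' i q.1 q.2` mentions `(q.1, q.2)`; rewrite by `Prod.mk.eta` rather than by unfolding)
    refine (h1.smul h2).congr fun q _ ↦ ?_
    simp only [hg', Prod.mk.eta, Pi.smul_apply']
  have hg'c₀ : ∀ i, ContinuousOn (g' i p₀) (extChartAt I i).target := fun i ↦
    ((hg'c i).comp (f := fun y ↦ (p₀, y)) (continuous_const.prodMk continuous_id).continuousOn
      fun y hy ↦ ⟨hp₀, hy⟩).congr fun _ _ ↦ rfl
  -- integrability: continuous on the target, zero off the compact `K i`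
  have hgint : ∀ i, ∀ p ∈ U, IntegrableOn (g i p) (extChartAt I i).target e.addHaar := by
    intro i p hp
    refine (((hgc i p hp).mono (hKt i)).integrableOn_compact (hKc i)).of_forall_sdiff_eq_zero
      (hmeas i) fun y hy ↦ ?_
    simp only [hg, hρ0 i y hy.1 hy.2, mul_zero, zero_mul]
  have hg'int : ∀ i, IntegrableOn (g' i p₀) (extChartAt I i).target e.addHaar := by
    intro i
    refine (((hg'c₀ i).mono (hKt i)).integrableOn_compact (hKc i)).of_forall_sdiff_eq_zero
      (hmeas i) fun y hy ↦ ?_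
    simp only [hg', hρ0 i y hy.1 hy.2, mul_zero, zero_smul]
  -- the parameter derivative of `g i · y`
  have hgd : ∀ i, ∀ y ∈ (extChartAt I i).target, ∀ p ∈ U,
      HasFDerivAt (fun p' ↦ g i p' y) (g' i p y) p := by
    intro i y hy p hp
    -- (build the composite first: unification against the `set` abbreviations is fragile)
    have h1 := (hΦd i (p, y) ⟨hp, hy⟩).comp p (hasFDerivAt_prodMk_left (𝕜 := ℝ) p y)
    have h2 := h1.const_mul (chartSign o i y * ρ i ((extChartAt I i).symm y))
    simp only [hg, hg']
    exact h2
  -- chart by chart: differentiation under the integral sign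
  have hchart : ∀ i ∈ S, HasFDerivAt (fun p ↦ ∫ y in (extChartAt I i).target, g i p y ∂e.addHaar)
      (∫ y in (extChartAt I i).target, g' i p₀ y ∂e.addHaar) p₀ := by
    intro i _
    -- a uniform bound for the derivative on `closedBall p₀ ε × K i`
    obtain ⟨C, hC⟩ : ∃ C, ∀ q ∈ closedBall p₀ ε ×ˢ K i, ‖g' i q.1 q.2‖ ≤ C :=
      ((isCompact_closedBall p₀ ε).prod (hKc i)).exists_bound_of_continuousOn
        ((hg'c i).mono (prod_mono hball (hKt i)))
    set bound : E → ℝ := (K i).indicator fun _ ↦ max C 0 with hbound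
    have hbi : IntegrableOn bound (extChartAt I i).target e.addHaar := by
      rw [hbound]
      exact ((integrable_indicator_iff (hKc i).measurableSet).2
        (integrableOn_const ((hKc i).measure_lt_top).ne)).integrableOn
    refine hasFDerivAt_integral_of_dominated_of_fderiv_le
      (μ := e.addHaar.restrict (extChartAt I i).target) (F' := g' i) (bound := bound)
      (closedBall_mem_nhds p₀ hε) ?_ (hgint i p₀ hp₀) ((hg'c₀ i).aestronglyMeasurable (hmeas i))
      ?_ hbi ?_
    · filter_upwards [hU.mem_nhds hp₀] with p hp
      exact (hgc i p hp).aestronglyMeasurable (hmeas i)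
    · rw [ae_restrict_iff' (hmeas i)]
      refine Eventually.of_forall fun y hy p hp ↦ ?_
      by_cases hyK : y ∈ K i
      · rw [hbound, indicator_of_mem hyK]
        exact (hC (p, y) ⟨hp, hyK⟩).trans (le_max_left _ _)
      · rw [hbound, indicator_of_notMem hyK]
        simp only [hg', hρ0 i y hy hyK, mul_zero, zero_smul, norm_zero, le_refl]
    · rw [ae_restrict_iff' (hmeas i)]
      exact Eventually.of_forall fun y hy p hp ↦ hgd i y hy p (hball hp)
  -- sum over the finite set of charts
  refine ⟨∑ i ∈ S, ∫ y in (extChartAt I i).target, g' i p₀ y ∂e.addHaar, ?_, fun h ↦ ?_⟩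
  · have hfun : (fun p ↦ (F p).integral o) =
        fun p ↦ ∑ i ∈ S, ∫ y in (extChartAt I i).target, g i p y ∂e.addHaar := funext hsum
    rw [hfun]
    exact HasFDerivAt.fun_sum fun i hi ↦ hchart i hi
  · -- evaluate the derivative at `h`: back to the defining chart sum
    rw [_root_.sum_apply]
    have hterm : ∀ i ∈ S, (∫ y in (extChartAt I i).target, g' i p₀ y ∂e.addHaar) h =
        ∫ y in (extChartAt I i).target, chartSign o i y * ρ i ((extChartAt I i).symm y) *
          fderiv ℝ (fun p ↦ (F p).inChart i y e) p₀ h ∂e.addHaar := by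
      intro i _
      rw [ContinuousLinearMap.integral_apply (hg'int i) h]
      refine setIntegral_congr_fun (hmeas i) fun y hy ↦ ?_
      have hd := (hΦd i (p₀, y) ⟨hp₀, hy⟩).comp p₀ (hasFDerivAt_prodMk_left (𝕜 := ℝ) p₀ y)
      have hfun : (fun p ↦ (F p).inChart i y e) = (Φ i ∘ fun p ↦ (p, y)) := rfl
      rw [hfun, hd.fderiv]
      simp only [hg', _root_.smul_apply, ContinuousLinearMap.coe_comp,
        Function.comp_apply, smul_eq_mul]
    rw [Finset.sum_congr rfl hterm]
    symm
    apply finsum_eq_sum_of_support_subset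
    intro i hi
    by_contra hiS
    apply hi
    simp only [hS0 i hiS, mul_zero, zero_mul, integral_zero]

/-- **Differentiation under `∫_M` with known pointwise derivatives.** In the situation of
`hasFDerivAt_integral_of_contDiffOn`, if the pointwise parameter derivatives of the family are
known, `∂_p (F p x)|_{p₀} = G x` for every `x : M`, then the derivative of `p ↦ ∫_M F p` at `p₀`
in the direction `h` is `∫_M (x ↦ G x h)`. [cite: LeeSmoothManifolds2013, Prop. 16.6] -/
theorem hasFDerivAt_integral_of_contDiffOn_of_hasFDerivAt (ho : IsContinuousOrientation o)
    (F : P → Literature.Geometry.Kaehler.MForm I M ℝ n) {p₀ : P} {U : Set P} (hU : IsOpen U)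
    (hp₀ : p₀ ∈ U)
    (hF : ∀ i : M, ContDiffOn ℝ 1 (fun q : P × E ↦ (F q.1).inChart i q.2 (modelBasis E n))
      (U ×ˢ (extChartAt I i).target))
    {G : M → P →L[ℝ] (E [⋀^Fin n]→L[ℝ] ℝ)}
    (hG : ∀ x, HasFDerivAt (fun p ↦ (F p x : E [⋀^Fin n]→L[ℝ] ℝ)) (G x) p₀) :
    ∃ L : P →L[ℝ] ℝ, HasFDerivAt (fun p ↦ (F p).integral o) L p₀ ∧
      ∀ h, L h = Literature.Geometry.Kaehler.MForm.integral o
        (fun x ↦ G x h : Literature.Geometry.Kaehler.MForm I M ℝ n) := by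
  obtain ⟨L, hL, hLh⟩ := hasFDerivAt_integral_of_contDiffOn ho F hU hp₀ hF
  refine ⟨L, hL, fun h ↦ ?_⟩
  rw [hLh h]
  change _ = ∑ᶠ i : M, _
  refine finsum_congr fun i ↦ ?_
  refine setIntegral_congr_fun (isOpen_extChartAt_target i).measurableSet fun y _ ↦ ?_
  congr 1
  -- `∂_p [(F p).inChart i y (e)] h = (G x h)̂_i(y)(e)`, `x = chart⁻¹ y`
  set x := (extChartAt I i).symm y with hx
  set D := mfderivWithin 𝓘(ℝ, E) I (extChartAt I i).symm (range I) y with hD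
  set v : Fin n → E := fun j ↦ D (modelBasis E n j) with hv
  set A := ContinuousAlternatingMap.apply ℝ E ℝ v with hA
  have hfun : (fun p ↦ (F p).inChart i y (modelBasis E n)) =
      (⇑A ∘ fun p ↦ (F p x : E [⋀^Fin n]→L[ℝ] ℝ)) :=
    funext fun _ ↦ rfl
  have hc : HasFDerivAt (⇑A ∘ fun p ↦ (F p x : E [⋀^Fin n]→L[ℝ] ℝ)) (A.comp (G x)) p₀ :=
    A.hasFDerivAt.comp p₀ (hG x)
  rw [hfun, hc.fderiv]
  rfl

end Literature.NumberTheory.Transcendental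

end
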